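import Literature.LinearAlgebra.Matrix.RealBilinearSwapTensorInvariance   -- part 1 (this seat): scalar rules, `sum_sum_conj_single_swap_eq`, `sum_sum_smul_conj_single_same_eq`
import HarnessLib

/-!
# The Pauli-frame sum of a REAL bilinear map over a `U(H)`-conjugate frame is a degree-two polynomial in the block projector: the frame-free Casimir tensor of an
# `𝔰𝔲(2)`-block of `𝔲(H)` (Fierz ∕ completeness `Σ σ_a ⊗ σ_a = 2·SWAP − 1⊗1` and its sesquilinear twin; Hall GTM 222 §3.5–§3.6, Horn–Johnson §2.2)

Topic `LinearAlgebra/Matrix`; namespace `Literature.LinearAlgebra.Matrix.SU2Block` (the Pauli-frame conventions of ★ `UnitaryBlockPauliFrameTrace`).  THEOREMS ONLY (no `def`,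
no instance, no notation, no axiom, no named fact, no `sorry`).  Written for cell `pub/hodgecm-mathlib` (ENGINE T1, crux H413 = `stmt-HodgeConjecture-24833`), ROAD A brick
**(A4-0) «CASIMIR TENSOR OF `𝔰𝔲(x^⊥)` IN THE CHART»** (F0P3a-p05 (g13) census 19b229d9 §2; A-p14 (g29) census 8d63e285 «frame-free form»; LEAD F0P3a-plan (g10) T9-14 (4)),
part 2 of 2 — the head; consumer: `Geometry/ComplexHyperbolic/UnitBallCasimirTensorChart` (the `U(2,1)` instance: the transversal Hessian of ★ `ArchCompactWallTransversalTrace` becomes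
a polynomial in the pencil `P(lift(g • x₀))`, hence a sheet integrand for the (A3-c) ENGINE).  Author A-p14 (g29), 2026-09-01.

THE MATHEMATICS.  `H = diag e` real, nowhere zero, `e_i = e_j` (`i ≠ j`); Pauli frame of the `(i,j)`-block `y₁ = I•(E_ii − E_jj)`, `y₂ = E_ij − E_ji`, `y₃ = I•(E_ij + E_ji)`
(`E_kl = Matrix.single k l 1`); `M` `H`-unitary (`MᴴHM = H`) with two-sided inverse `M′` — ANY element of `U(H)`, no block-diagonality; `P := M(E_ii + E_jj)M′` = the
`H`-orthogonal projector onto the plane `M·span(e_i, e_j)`.  WHY: an explicit `H`-orthonormal frame of that plane is gauge-dependent (and, along the hyperboloid sheets of the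
ball model, cannot be chosen both √-rational and continuous), but the FRAME SUM `Σ_a q(My_aM′, My_aM′)` of a real bilinear `q` is gauge-free — it is a polynomial in `P`:
* §3 (`M = 1`) by expansion, only `k, l ∈ {i,j}` contribute:
  `Σ_a q(y_a, y_a) = Σ_{k,l} ( w_kl • [q(E_kl Π₀, Π₀ E_kl) + q(I•E_kl Π₀, I•Π₀ E_kl)] − q(E_kl Π₀, E_lk Π₀) + q(I•E_kl Π₀, I•E_lk Π₀) ) − q(I•Π₀, I•Π₀)`, `Π₀ = E_ii + E_jj`,
  for any real weights `w` equal to `1` on the block;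
* §4 HEAD **`sum_conj_frame_eq_casimir`**: `Σ_a q(My_aM′, My_aM′) = Σ_{k,l} ( re(e_l∕e_k) • [q(E_kl P, P E_kl) + q(I•E_kl P, I•P E_kl)] − q(E_kl P, E_lk P) + q(I•E_kl P, I•E_lk P) ) − q(I•P, I•P)`
  (§3 for the conjugated form `q(M·M′, M·M′)`, `M(XΠ₀)M′ = (MXM′)P`, `M(Π₀X)M′ = P(MXM′)`, then part 1's SWAP-invariance for `q(·P, ·P)` and hermitian-twin invariance for `q(·P, P·)`);
  the `ℂ`-bilinear half of `Σ_a y_a ⊗ y_a` is Fierz's `−(2·SWAP∘(P⊗P) − P⊗P)`, the sesquilinear half `Σ_a y_a ⊗ ȳ_a` is where `M′ = H⁻¹MᴴH` enters; **`casimir_rhs_smul`**: the right side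
  is homogeneous of degree two in `P` (`P ↦ c•P` multiplies it by `c²`) — the `ε`-scaling socket of the ball chart (`P = ε⁻¹ • P̃`, `P̃` polynomial on the sheets).
★ `sum_conj_frame_eq_sum_frame` (block-diagonal `M`) is the special case `P = Π₀`.
HONEST LABEL: elementary linear algebra; for the cell it pays nothing by itself (HC_CM is proved only modulo the printed citations until rung 0 closes).

## References
* [Hall2015] B. C. Hall, *Lie Groups, Lie Algebras, and Representations*, 2nd ed., GTM 222 (2015), §3.5 (the adjoint action of `U(2)` on `𝔰𝔲(2)`), §3.6 (complexification; real forms).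
* [HornJohnson2013] R. A. Horn, C. R. Johnson, *Matrix Analysis*, 2nd ed. (2013), §0.2 (matrix units), §2.2 (unitary similarity; the trace form is basis-free).
-/

set_option autoImplicit false

noncomputable section

open Finset Matrix Complex
open scoped ComplexConjugate

namespace Literature.LinearAlgebra.Matrix.SU2Block

variable {N : ℕ} {E : Type*} [AddCommGroup E] [Module ℝ E]

/-! ## §3 The block case `M = 1`: the Pauli-frame sum expanded against the block projector `Π₀ = E_ii + E_jj` -/

/-- `E_kl · Π₀ = E_kl` if `l ∈ {i,j}`, else `0` (`Π₀ = E_ii + E_jj`, `i ≠ j`). [cite: HornJohnson2013, §0.2] -/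
theorem single_mul_blockProj {i j : Fin N} (hij : i ≠ j) (k l : Fin N) :
    Matrix.single k l (1 : ℂ) * (Matrix.single i i (1 : ℂ) + Matrix.single j j 1) = if (l = i ∨ l = j) then Matrix.single k l 1 else 0 := by
  rw [Matrix.mul_add]
  by_cases hli : l = i
  · subst hli
    rw [if_pos (Or.inl rfl), Matrix.single_mul_single_same, mul_one, Matrix.single_mul_single_of_ne (h := hij), add_zero]
  · by_cases hlj : l = j
    · subst hlj
      rw [if_pos (Or.inr rfl), Matrix.single_mul_single_of_ne (h := hli), Matrix.single_mul_single_same, mul_one, zero_add]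
    · rw [if_neg (not_or.2 ⟨hli, hlj⟩), Matrix.single_mul_single_of_ne (h := hli), Matrix.single_mul_single_of_ne (h := hlj), add_zero]

/-- `Π₀ · E_kl = E_kl` if `k ∈ {i,j}`, else `0`. [cite: HornJohnson2013, §0.2] -/
theorem blockProj_mul_single {i j : Fin N} (hij : i ≠ j) (k l : Fin N) :
    (Matrix.single i i (1 : ℂ) + Matrix.single j j 1) * Matrix.single k l (1 : ℂ) = if (k = i ∨ k = j) then Matrix.single k l 1 else 0 := by
  rw [Matrix.add_mul]
  by_cases hki : k = i
  · subst hki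
    rw [if_pos (Or.inl rfl), Matrix.single_mul_single_same, one_mul, Matrix.single_mul_single_of_ne (h := Ne.symm hij), add_zero]
  · by_cases hkj : k = j
    · subst hkj
      rw [if_pos (Or.inr rfl), Matrix.single_mul_single_of_ne (h := Ne.symm hki), Matrix.single_mul_single_same, one_mul, zero_add]
    · rw [if_neg (not_or.2 ⟨hki, hkj⟩), Matrix.single_mul_single_of_ne (h := Ne.symm hki), Matrix.single_mul_single_of_ne (h := Ne.symm hkj), add_zero]

/-- **THE PAULI-FRAME SUM AT THE BLOCK ITSELF** (`M = 1`): for every real bilinear `q` and any real weights `w` equal to `1` on the block,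
`q(y₁,y₁) + q(y₂,y₂) + q(y₃,y₃) = Σ_{k,l} ( w_kl • [q(E_klΠ₀, Π₀E_kl) + q(I•E_klΠ₀, I•Π₀E_kl)] − q(E_klΠ₀, E_lkΠ₀) + q(I•E_klΠ₀, I•E_lkΠ₀) ) − q(I•Π₀, I•Π₀)`
with `Π₀ = E_ii + E_jj` — pure expansion: only `k, l ∈ {i,j}` contribute. [cite: Hall2015, Prop. 3.24] -/
theorem sum_frame_eq_casimir_blockProj (q : Matrix (Fin N) (Fin N) ℂ →ₗ[ℝ] Matrix (Fin N) (Fin N) ℂ →ₗ[ℝ] E) {i j : Fin N} (hij : i ≠ j)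
    (w : Fin N → Fin N → ℝ) (hwii : w i i = 1) (hwij : w i j = 1) (hwji : w j i = 1) (hwjj : w j j = 1) :
    q (I • (Matrix.single i i (1 : ℂ) - Matrix.single j j 1)) (I • (Matrix.single i i (1 : ℂ) - Matrix.single j j 1)) +
      q (Matrix.single i j (1 : ℂ) - Matrix.single j i 1) (Matrix.single i j (1 : ℂ) - Matrix.single j i 1) +
      q (I • (Matrix.single i j (1 : ℂ) + Matrix.single j i 1)) (I • (Matrix.single i j (1 : ℂ) + Matrix.single j i 1)) =
    (∑ k, ∑ l, (w k l • (q (Matrix.single k l (1 : ℂ) * (Matrix.single i i (1 : ℂ) + Matrix.single j j 1))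
            ((Matrix.single i i (1 : ℂ) + Matrix.single j j 1) * Matrix.single k l (1 : ℂ)) +
          q (I • (Matrix.single k l (1 : ℂ) * (Matrix.single i i (1 : ℂ) + Matrix.single j j 1)))
            (I • ((Matrix.single i i (1 : ℂ) + Matrix.single j j 1) * Matrix.single k l (1 : ℂ)))) -
        q (Matrix.single k l (1 : ℂ) * (Matrix.single i i (1 : ℂ) + Matrix.single j j 1))
          (Matrix.single l k (1 : ℂ) * (Matrix.single i i (1 : ℂ) + Matrix.single j j 1)) +
        q (I • (Matrix.single k l (1 : ℂ) * (Matrix.single i i (1 : ℂ) + Matrix.single j j 1)))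
          (I • (Matrix.single l k (1 : ℂ) * (Matrix.single i i (1 : ℂ) + Matrix.single j j 1))))) -
      q (I • (Matrix.single i i (1 : ℂ) + Matrix.single j j 1)) (I • (Matrix.single i i (1 : ℂ) + Matrix.single j j 1)) := by
  simp_rw [single_mul_blockProj hij, blockProj_mul_single hij]
  -- the summand and its support
  set f : Fin N → Fin N → E := fun k l =>
    w k l • (q (if (l = i ∨ l = j) then Matrix.single k l (1 : ℂ) else 0) (if (k = i ∨ k = j) then Matrix.single k l (1 : ℂ) else 0) +
        q (I • (if (l = i ∨ l = j) then Matrix.single k l (1 : ℂ) else 0)) (I • (if (k = i ∨ k = j) then Matrix.single k l (1 : ℂ) else 0))) -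
      q (if (l = i ∨ l = j) then Matrix.single k l (1 : ℂ) else 0) (if (k = i ∨ k = j) then Matrix.single l k (1 : ℂ) else 0) +
      q (I • (if (l = i ∨ l = j) then Matrix.single k l (1 : ℂ) else 0)) (I • (if (k = i ∨ k = j) then Matrix.single l k (1 : ℂ) else 0))
    with hf
  have hrow : ∀ k, ¬(k = i ∨ k = j) → ∀ l, f k l = 0 := fun k hk l => by
    simp only [hf, if_neg hk, smul_zero, map_zero, add_zero, sub_zero]
  have hcol : ∀ k l, ¬(l = i ∨ l = j) → f k l = 0 := fun k l hl => by
    simp only [hf, if_neg hl, smul_zero, map_zero, LinearMap.zero_apply, add_zero, smul_zero, sub_zero]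
  have hval : ∀ k l, (k = i ∨ k = j) → (l = i ∨ l = j) → f k l =
      w k l • (q (Matrix.single k l (1 : ℂ)) (Matrix.single k l 1) + q (I • Matrix.single k l (1 : ℂ)) (I • Matrix.single k l (1 : ℂ))) -
        q (Matrix.single k l (1 : ℂ)) (Matrix.single l k 1) + q (I • Matrix.single k l (1 : ℂ)) (I • Matrix.single l k (1 : ℂ)) := fun k l hk hl => by
    simp only [hf, if_pos hk, if_pos hl]
  show _ = (∑ k, ∑ l, f k l) - _
  -- only the four block pairs survive
  have hsum : (∑ k, ∑ l, f k l) = (f i i + f i j) + (f j i + f j j) := by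
    rw [Finset.sum_eq_add i j hij (fun k _ hk => Finset.sum_eq_zero fun l _ => hrow k (not_or.2 hk) l)
      (fun h => absurd (Finset.mem_univ _) h) (fun h => absurd (Finset.mem_univ _) h)]
    rw [Finset.sum_eq_add i j hij (fun l _ hl => hcol i l (not_or.2 hl)) (fun h => absurd (Finset.mem_univ _) h) (fun h => absurd (Finset.mem_univ _) h),
      Finset.sum_eq_add i j hij (fun l _ hl => hcol j l (not_or.2 hl)) (fun h => absurd (Finset.mem_univ _) h) (fun h => absurd (Finset.mem_univ _) h)]
  rw [hsum, hval i i (Or.inl rfl) (Or.inl rfl), hval i j (Or.inl rfl) (Or.inr rfl), hval j i (Or.inr rfl) (Or.inl rfl), hval j j (Or.inr rfl) (Or.inr rfl),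
    hwii, hwij, hwji, hwjj, one_smul, one_smul, one_smul, one_smul]
  simp only [smul_add, smul_sub, map_add, map_sub, LinearMap.add_apply, LinearMap.sub_apply]
  abel


/-! ## §4 The head: the Pauli-frame sum of any `U(H)`-conjugate frame is a degree-two polynomial in the block projector -/

/-- **THE FRAME-FREE CASIMIR IDENTITY.**  Let `H = diag e` be real and nowhere zero with `e_i = e_j` (`i ≠ j`), `M` `H`-unitary (`Mᴴ H M = H`) with two-sided inverse `M′`
(NO block-diagonality is assumed), `y₁ = I•(E_ii − E_jj)`, `y₂ = E_ij − E_ji`, `y₃ = I•(E_ij + E_ji)` the Pauli frame of the `(i,j)`-block and `P = M (E_ii + E_jj) M′` the conjugated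
block projector.  Then for EVERY real bilinear `q : M_N(ℂ) × M_N(ℂ) → E`:
`q(My₁M′, My₁M′) + q(My₂M′, My₂M′) + q(My₃M′, My₃M′) = Σ_{k,l} ( re(e_l∕e_k) • [q(E_kl P, P E_kl) + q(I•E_kl P, I•P E_kl)] − q(E_kl P, E_lk P) + q(I•E_kl P, I•E_lk P) ) − q(I•P, I•P)`
— `4N² + 1` values of `q` at products of `P` with CONSTANT matrix units, homogeneous of degree two in `P`.  (The `ℂ`-bilinear half of `Σ_a y_a ⊗ y_a` is Fierz's
`−(2·SWAP∘(P⊗P) − P⊗P)`; the sesquilinear half `Σ_a y_a ⊗ ȳ_a` is where `M′ = H⁻¹MᴴH` enters.)  Proof: §3 for the conjugated form `q(M·M′, M·M′)`, then §2's two invariances.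
★ `sum_conj_frame_eq_sum_frame` (block-diagonal `M`, `P = E_ii + E_jj`) is the special case `M(E_ii+E_jj)M′ = E_ii + E_jj`. [cite: Hall2015, Prop. 3.24] [cite: HornJohnson2013, §2.2] -/
theorem sum_conj_frame_eq_casimir (q : Matrix (Fin N) (Fin N) ℂ →ₗ[ℝ] Matrix (Fin N) (Fin N) ℂ →ₗ[ℝ] E) {i j : Fin N} (hij : i ≠ j)
    {e : Fin N → ℂ} (he : ∀ k, e k ≠ 0) (hereal : ∀ k, conj (e k) = e k) (heij : e i = e j)
    {M M' : Matrix (Fin N) (Fin N) ℂ} (hMH : Mᴴ * Matrix.diagonal e * M = Matrix.diagonal e) (hMM' : M * M' = 1) (hM'M : M' * M = 1)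
    (P : Matrix (Fin N) (Fin N) ℂ) (hP : P = M * (Matrix.single i i (1 : ℂ) + Matrix.single j j 1) * M') :
    q (M * (I • (Matrix.single i i (1 : ℂ) - Matrix.single j j 1)) * M') (M * (I • (Matrix.single i i (1 : ℂ) - Matrix.single j j 1)) * M') +
      q (M * (Matrix.single i j (1 : ℂ) - Matrix.single j i 1) * M') (M * (Matrix.single i j (1 : ℂ) - Matrix.single j i 1) * M') +
      q (M * (I • (Matrix.single i j (1 : ℂ) + Matrix.single j i 1)) * M') (M * (I • (Matrix.single i j (1 : ℂ) + Matrix.single j i 1)) * M') =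
    (∑ k, ∑ l, ((e l / e k).re • (q (Matrix.single k l (1 : ℂ) * P) (P * Matrix.single k l (1 : ℂ)) +
          q (I • (Matrix.single k l (1 : ℂ) * P)) (I • (P * Matrix.single k l (1 : ℂ)))) -
        q (Matrix.single k l (1 : ℂ) * P) (Matrix.single l k (1 : ℂ) * P) +
        q (I • (Matrix.single k l (1 : ℂ) * P)) (I • (Matrix.single l k (1 : ℂ) * P)))) -
      q (I • P) (I • P) := by
  -- (1) §3 for the conjugated form `q(M·M′, M·M′)`
  have hwkk : ∀ k, (e k / e k).re = 1 := fun k => by rw [div_self (he k), Complex.one_re]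
  have h4 := sum_frame_eq_casimir_blockProj (q.compl₁₂ ((LinearMap.mulRight ℝ M').comp (LinearMap.mulLeft ℝ M)) ((LinearMap.mulRight ℝ M').comp (LinearMap.mulLeft ℝ M)))
    hij (fun k l => (e l / e k).re) (hwkk i) (by rw [heij, hwkk]) (by rw [heij, hwkk]) (hwkk j)
  simp only [LinearMap.compl₁₂_apply, LinearMap.comp_apply, LinearMap.mulLeft_apply, LinearMap.mulRight_apply] at h4
  -- (2) split the conjugation across the products: `M (X Π₀) M′ = (M X M′) P`, `M (Π₀ X) M′ = P (M X M′)`, `M (I•X) M′ = I•(M X M′)`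
  have hXP : ∀ X : Matrix (Fin N) (Fin N) ℂ, M * (X * (Matrix.single i i (1 : ℂ) + Matrix.single j j 1)) * M' = M * X * M' * P := fun X => by
    rw [hP]
    calc M * (X * (Matrix.single i i (1 : ℂ) + Matrix.single j j 1)) * M'
        = M * X * (M' * M) * (Matrix.single i i (1 : ℂ) + Matrix.single j j 1) * M' := by rw [hM'M, Matrix.mul_one]; simp only [Matrix.mul_assoc]
      _ = M * X * M' * (M * (Matrix.single i i (1 : ℂ) + Matrix.single j j 1) * M') := by simp only [Matrix.mul_assoc]
  have hPX : ∀ X : Matrix (Fin N) (Fin N) ℂ, M * ((Matrix.single i i (1 : ℂ) + Matrix.single j j 1) * X) * M' = P * (M * X * M') := fun X => by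
    rw [hP]
    calc M * ((Matrix.single i i (1 : ℂ) + Matrix.single j j 1) * X) * M'
        = M * (Matrix.single i i (1 : ℂ) + Matrix.single j j 1) * (M' * M) * X * M' := by rw [hM'M, Matrix.mul_one]; simp only [Matrix.mul_assoc]
      _ = M * (Matrix.single i i (1 : ℂ) + Matrix.single j j 1) * M' * (M * X * M') := by simp only [Matrix.mul_assoc]
  have hIX : ∀ X : Matrix (Fin N) (Fin N) ℂ, M * (I • X) * M' = I • (M * X * M') := fun X => by rw [Matrix.mul_smul, Matrix.smul_mul]
  simp only [hIX, hXP, hPX] at h4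
  rw [← hP] at h4
  rw [hIX, hIX, h4]
  -- (3) §2: the two invariances, for the forms `q(·P, P·)` and `q(·P, ·P)`
  have hH := sum_sum_smul_conj_single_same_eq (q.compl₁₂ (LinearMap.mulRight ℝ P) (LinearMap.mulLeft ℝ P)) he hereal hMH hMM'
  simp only [LinearMap.compl₁₂_apply, LinearMap.mulLeft_apply, LinearMap.mulRight_apply, Matrix.smul_mul, Matrix.mul_smul] at hH
  have hT := sum_sum_conj_single_swap_eq (q.compl₁₂ (LinearMap.mulRight ℝ P) (LinearMap.mulRight ℝ P)) hMM'
  simp only [LinearMap.compl₁₂_apply, LinearMap.mulRight_apply, Matrix.smul_mul] at hT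
  have hre : ∀ a b c : Fin N → Fin N → E, ∑ k, ∑ l, (a k l - b k l + c k l) = (∑ k, ∑ l, a k l) - ∑ k, ∑ l, (b k l - c k l) := fun a b c => by
    simp only [Finset.sum_add_distrib, Finset.sum_sub_distrib]; abel
  rw [hre, hH, hT, ← hre]

/-- **HOMOGENEITY**: the right-hand side of ★ `sum_conj_frame_eq_casimir` is homogeneous of degree two in `P`: replacing `P` by `c • P` (`c` real) multiplies it by `c²`
(this is the `ε`-scaling socket: on the hyperboloid sheets `P = ε⁻¹ • P̃` with `P̃` polynomial). [cite: Hall2015, Prop. 3.24] -/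
theorem casimir_rhs_smul (q : Matrix (Fin N) (Fin N) ℂ →ₗ[ℝ] Matrix (Fin N) (Fin N) ℂ →ₗ[ℝ] E) (e : Fin N → ℂ) (c : ℝ) (P : Matrix (Fin N) (Fin N) ℂ) :
    (∑ k, ∑ l, ((e l / e k).re • (q (Matrix.single k l (1 : ℂ) * ((c : ℂ) • P)) (((c : ℂ) • P) * Matrix.single k l (1 : ℂ)) +
          q (I • (Matrix.single k l (1 : ℂ) * ((c : ℂ) • P))) (I • (((c : ℂ) • P) * Matrix.single k l (1 : ℂ)))) -
        q (Matrix.single k l (1 : ℂ) * ((c : ℂ) • P)) (Matrix.single l k (1 : ℂ) * ((c : ℂ) • P)) +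
        q (I • (Matrix.single k l (1 : ℂ) * ((c : ℂ) • P))) (I • (Matrix.single l k (1 : ℂ) * ((c : ℂ) • P))))) -
      q (I • ((c : ℂ) • P)) (I • ((c : ℂ) • P)) =
    c ^ 2 • ((∑ k, ∑ l, ((e l / e k).re • (q (Matrix.single k l (1 : ℂ) * P) (P * Matrix.single k l (1 : ℂ)) +
          q (I • (Matrix.single k l (1 : ℂ) * P)) (I • (P * Matrix.single k l (1 : ℂ)))) -
        q (Matrix.single k l (1 : ℂ) * P) (Matrix.single l k (1 : ℂ) * P) +
        q (I • (Matrix.single k l (1 : ℂ) * P)) (I • (Matrix.single l k (1 : ℂ) * P)))) -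
      q (I • P) (I • P)) := by
  simp only [Matrix.mul_smul, Matrix.smul_mul, Complex.coe_smul, smul_comm I c, map_smul, LinearMap.smul_apply, smul_smul, ← pow_two,
    Finset.smul_sum, smul_add, smul_sub, smul_comm (c ^ 2) ((e _ / e _).re)]

end Literature.LinearAlgebra.Matrix.SU2Block

end
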